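import Summits.HodgeConjecture.HodgeConjecture.Theorems.VHCAbelianSchemesRoadSecantQuotientServedLefschetz
import Summits.HodgeConjecture.HodgeConjecture.Theorems.VHCAbelianSchemesRoadServedFibreLocal
import Summits.HodgeConjecture.HodgeConjecture.Theorems.Ring2AbelianAllEllipticPowerCarriersDefs
import Summits.HodgeConjecture.HodgeConjecture.Theorems.VHCAbelianSchemesRoadEllipticPowerAnchors
import Literature.AlgebraicGeometry.Motives.AbelianVarietyProductIsogeny
import Literature.AlgebraicGeometry.Motives.AbelianVarietyPoincareCompleteReducibility
import Literature.AlgebraicGeometry.Milne1999.CMTypeSubquotients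
import HarnessLib

/-!
# Road b02 (`VHCAbelianSchemesRoad`, D-0059) — lane W1 of crux `SemiregularSheafRepresentativesTwAtDiag` (item stmt-HodgeConjecture-19787),
# stub 2a″ `stub_anchorCarrier_63_secantQuotientPinned` AT THE SPLIT SPECIAL FIBRES OF `E³`-TYPE ∕ CM TYPE: the E³-type and CM secant–quotient
# anchors ARE anchors of the André column, 2a″ there is BY NAME an instance of the column's elliptic-power ∕ CM carrier nodes, and the
# served half of the `(6,3)` cell plus the spreading of algebraicity along every pencil through such a fibre follow (fact-free)

research route conditional on HC_CM; not a corollary; Q11.4-sentence-2 already refuted in dim ≥ 3.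

THEOREMS ONLY (no definition, no named fact, no claim-tagged fact imported; `HC_CM` nowhere). Second prover unit on the crux (director-hodge
W1, 2026-08-27: «explicit construction on a split special fibre — exhibit the `(6,3)` secant–quotient representative on `E³`-type ∕ CM abelian
sixfolds via the landed carriers-by-codimension and anchor transport, then spread by the served-fibre lemma»; LEAD card rev 5 LANES: files of this
lane are named `…SecantQuotientAnchorCM*`, disjoint from lane R = `…SecantQuotientResidual*`).

WHAT IS PROVED. Let `D` be a secant–quotient datum (genus-3 curve, `J = J(C)`, principal `Θ`, even `d ≥ 4`, `G₁, G₂`; `D.P = J × Ĵ`,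
`D.Y = (J × Ĵ)/Ḡ`, `D.q` the quotient isogeny — `VHCAbelianSchemesRoadSecantQuotientAnchorDefs`), `(X, θ)` a PINNED anchor
(`secantQuotientAnchorsPinned`, `VHCAbelianSchemesRoadSecantQuotientAnchorPinnedDefs` p512578) and `𝔖^pin X θ` its served classes.
* §1 Isogeny bookkeeping (Mumford §19, Milne I §8): `Ĵ ∼ J` (`φ_Θ`), `Y ∼ J × Ĵ` (`q`), `E^{m+1} × E^{n+1} ∼ E^{m+n+2}`; hence **if `J ∼ E₀³` then
  `Y ∼ E₀⁶`** (`SecantQuotientDatum.isIsogenous_Y_powSucc_five`), and **if `J` is of CM-type then so is `Y`** (`isOfCMType_Y`).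
* §2 So every chart `X ≅ D.Y.X` of an `E³`-TYPE datum is an ELLIPTIC-POWER ANCHOR of the André column (`AbelianAll.ellipticPowerPolarisedAnchor 6`,
  p508000) at every pinned polarisation, and every chart of a CM datum is a CM anchor (`AbelianAll.cmPolarisedAnchor 6`): the split special fibres
  the director names are, by name, the anchors at which the column's carrier nodes are stated.
* §3 RESTRICTION (door-generic, then the crux's twisted door): served classes are rational ALGEBRAIC (indeed algebraic-Lefschetz, ring2-b02 g90
  p523449 `IsSecantQuotientWeilClassAtPinned.mem_algebraicClasses`) and `θ` is a polarisation class, so for ANY anchor sub-family `𝔄₀` the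
  statement «2a″ on the pinned anchors lying in `𝔄₀`» follows from «carriers for algebraic classes at the polarised members of `𝔄₀`»
  (`anchoredCarrierAt_secantQuotientPinned_and_of_polarised`). Instances BY NAME: **2a″ at the `E³`-type anchors ⟸ `EllipticPowerAlgebraicCarriers 𝒪`**
  (node N of the §AbelianAll table at `(n, p) = (6, 3)`; twisted form ⟸ `EllipticPowerAlgebraicTwistedCarriers`), **2a″ at the CM anchors ⟸ the
  `(6,3)` instance of CM-anchored algebraic carriers** (displayed; the column's `CMAlgebraicCarriers` is stated for `n ≥ 2p + 4` only and does NOT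
  cover `(6,3)` — recorded, not hidden). Conversely 2a″ implies each restriction (`anchoredCarrierAt_anti`), so these are honest special cases.
* §4 THE CELL'S SERVED HALF on the pencils through such a fibre: `LefAtExceptionalRegimeAtUnder 𝒪 6 3 (HasServedFibre 6 3 (𝔄^pin ∧ E-power) 𝔖^pin)`
  ⟸ the node (PART AA-b engine `under_hasServedFibre_of_anchoredCarrierAt`, p494835).
* §5 SPREADING (the served-fibre lemmas, ab-andre-2 g60 p514736 and PART AA-e p496583 ∕ p497343): door ∧ node ⟹ on every smooth projective family
  of abelian sixfolds with a fibre `𝒳_{s₀}` that is a chart of an `E³`-type secant quotient, polarised by the restriction of a global `Θ` with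
  `Θ|_{s₀} = e^*h_Y(θ₀)`, at which the global fibrewise-Hodge class `W` restricts to a served class, `W` is ALGEBRAIC on an open neighbourhood of
  `s₀` (any smooth base) and on EVERY fibre (smooth irreducible affine curve base); twisted-door forms modulo the road's binder `TwistedPerfectDoorVHC`.

HONEST LIMITS (what this file does NOT do). (a) No carrier is constructed: the kernel has no semiregularity theorem for any explicit object
(the tree's `σ_q` are real maps on `Ext²`; no Hodge comparison), so the `E³`-type ∕ CM data enter BY NAME through the column's OPEN nodes —
exactly as every carrier of the road; nothing here says 2a″, any node, any cell, K-SR♭∃, VHC, `HC_AV`, `HC_CM` or HC holds. (b) At the class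
level the restriction is the whole content: at these anchors EVERY rational `(3,3)` class is algebraic-Lefschetz (`mem_algebraicClasses_of_ellipticPowerAnchor`,
Tate–Murasaki–van Geemen), so 2a″ there asks a semiregular representative, modulo the `θ`-ray, of a polynomial in divisor classes on (a quotient
of) `E₀⁶`. (c) Gap (G3) (card rev 5: one datum serves ONE direction) is untouched: at a fixed anchor the node serves every direction at once
because it is a per-class ∀-statement, not by a mechanism. (d) Non-emptiness of the `E³`-type pinned anchors (a genus-3 curve with `J ∼ E₀³`
satisfying Lemma 9.3.1's general position at some even `d ≥ 4`) is NOT proved here. (e) (c1)∕(c2) of p523449 stand: a constant pencil through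
such a fibre is served but never exceptional there; the pencils of §5 must be genuinely non-isotrivial to meet regime 2.

References: [cite: Markman2025SecantWeil, §1.5 (p. 7), Thm. 1.4.1 and Thm. 1.5.1] [cite: Andre1996Motifs, §6.3 Lemme 6.3.3 (ii) (p. 33)]
[cite: vanGeemen1994HodgeAV, Lemma 3.7 and Thm. 4.3] [cite: Bloch1972Semiregularity, Remark (7.5)] [cite: BuchweitzFlenner2003, §5 Thm. 5.1]
[cite: MumfordAV1970, §7 Thm. 4 and §19 (p. 169)] [cite: MilneAV2008, I §8 (p. 40)] [cite: Milne1999, §2 p. 54].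
-/

noncomputable section

open CategoryTheory CategoryTheory.Limits AlgebraicGeometry Topology

namespace Summit.HodgeConjecture.HodgeConjecture.Ring2.SemiregularRepresentatives

set_option linter.dupNamespace false -- the cell's namespace repeats the summit name, as in every `Ring2*` file

open Literature.AlgebraicGeometry Literature.AlgebraicGeometry.Motives Literature.AlgebraicGeometry.Motives.AbelianVariety
open Literature.AlgebraicGeometry.HodgeTheory Literature.AlgebraicGeometry.Markman2025
open Literature.AlgebraicTopology.SingularHomology
open Literature.AlgebraicGeometry.Milne1999 (IsOfCMType isOfCMType_iff_of_isIsogenous isOfCMType_prod_iff isOfCMType_powSucc_iff)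
open Summit.Ventures.HSemireg (ObjClass LocalVariationalHodgeFor)
open Summit.HodgeConjecture.HodgeConjecture.Ring2.AbelianAll (ellipticPowerPolarisedAnchor cmPolarisedAnchor algebraicServedClasses
  EllipticPowerAlgebraicCarriers EllipticPowerAlgebraicTwistedCarriers)

/-! ## §1 Isogeny bookkeeping: `Ĵ ∼ J`, `Y ∼ J × Ĵ`, powers of an elliptic curve, CM-type -/

section Isogeny

/-- An isomorphism of abelian varieties is an isogeny, so isomorphic abelian varieties are isogenous. [cite: MumfordAV1970, §19 (p. 169)] -/
theorem isIsogenous_of_iso {A B : AbelianVariety ℂ} (e : A ≅ B) : A.IsIsogenous B :=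
  ⟨e.hom, isIsogeny_hom_of_iso e⟩

/-- **`E^{m+1} × E^{n+1} ∼ E^{m+n+2}`** for the tree's iterated binary powers `AbelianVariety.powSucc` (re-bracketing the binary products
along the associator of the categorical product, then induction on `n`). [cite: MumfordAV1970, §19 (p. 169)] [folklore] -/
theorem isIsogenous_powSucc_prod_powSucc (E : AbelianVariety ℂ) (m n : ℕ) :
    ((E.powSucc m).prod (E.powSucc n)).IsIsogenous (E.powSucc (m + n + 1)) := by
  induction n with
  | zero => exact IsIsogenous.refl _
  | succ n ih =>
    rw [show m + (n + 1) + 1 = (m + n + 1) + 1 by omega, powSucc_succ, powSucc_succ]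
    -- `A × (B × E) ≅ (A × B) × E` for the tree's `AbelianVariety.prod`, via Mathlib's binary-product associator
    have e : (E.powSucc m).prod ((E.powSucc n).prod E) ≅ ((E.powSucc m).prod (E.powSucc n)).prod E :=
      (prodIsoProd _ _).symm ≪≫ prod.mapIso (Iso.refl _) (prodIsoProd _ _).symm ≪≫ (Limits.prod.associator _ _ _).symm ≪≫
        prod.mapIso (prodIsoProd _ _) (Iso.refl _) ≪≫ prodIsoProd _ _
    exact (isIsogenous_of_iso e).trans (ih.prod (IsIsogenous.refl E))

namespace SecantQuotientDatum

variable (D : SecantQuotientDatum)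

/-- `Ĵ ∼ J`: the polarisation isogeny `φ_Θ : J → Ĵ = J/K(Θ)`, reversed (isogeny is symmetric, Mumford §19).
[cite: MilneAV2008, I §8 (p. 40)] [cite: MumfordAV1970, §19 (p. 169)] -/
theorem isIsogenous_dual_J : (D.𝒥.J.dualOf D.Θ D.isAmple).IsIsogenous D.𝒥.J :=
  IsIsogenous.symm' ⟨D.𝒥.J.phiTheta D.Θ D.isAmple, D.𝒥.J.isIsogeny_phiTheta D.isAmple⟩

/-- `Y ∼ J × Ĵ`: the quotient isogeny `q`, reversed. [cite: MumfordAV1970, §7 Thm. 4 (p. 72) and §19 (p. 169)] -/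
theorem isIsogenous_Y_P : D.Y.IsIsogenous D.P :=
  IsIsogenous.symm' ⟨D.q, D.isIsogeny_q⟩

/-- **`E³`-TYPE DATA: if `J ∼ E₀³` then `J × Ĵ ∼ E₀⁶`.** [cite: MumfordAV1970, §19 (p. 169)] [cite: MilneAV2008, I §8 (p. 40)] -/
theorem isIsogenous_P_powSucc_five {E₀ : AbelianVariety ℂ} (hJ : D.𝒥.J.IsIsogenous (E₀.powSucc 2)) :
    D.P.IsIsogenous (E₀.powSucc 5) :=
  (IsIsogenous.prod hJ (D.isIsogenous_dual_J.trans hJ)).trans (isIsogenous_powSucc_prod_powSucc E₀ 2 2)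

/-- **`E³`-TYPE DATA: if `J ∼ E₀³` then the secant quotient `Y = (J × Ĵ)/Ḡ ∼ E₀⁶`** — the `E³`-type special fibre is, up to isogeny, a
sixth power of an elliptic curve. [cite: Markman2025SecantWeil, §1.5 (p. 7)] [cite: MumfordAV1970, §7 Thm. 4 and §19 (p. 169)] -/
theorem isIsogenous_Y_powSucc_five {E₀ : AbelianVariety ℂ} (hJ : D.𝒥.J.IsIsogenous (E₀.powSucc 2)) :
    D.Y.IsIsogenous (E₀.powSucc 5) :=
  D.isIsogenous_Y_P.trans (D.isIsogenous_P_powSucc_five hJ)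

/-- **CM DATA: if `J` is of CM-type then so is `Y = (J × Ĵ)/Ḡ`** (CM-type is isogeny-invariant and stable under products).
[cite: Milne1999, §2 p. 54] [cite: MumfordAV1970, §19 (p. 169)] -/
theorem isOfCMType_Y (hJ : IsOfCMType D.𝒥.J) : IsOfCMType D.Y := by
  have hdual : IsOfCMType (D.𝒥.J.dualOf D.Θ D.isAmple) := (isOfCMType_iff_of_isIsogenous D.isIsogenous_dual_J).2 hJ
  have hP : IsOfCMType D.P := (isOfCMType_prod_iff).2 ⟨hJ, hdual⟩
  exact (isOfCMType_iff_of_isIsogenous D.isIsogenous_Y_P).2 hP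

/-- If `J ∼ E₀³` with `E₀` of CM-type (a CM elliptic curve) then `J`, hence `Y`, is of CM-type. [cite: Milne1999, §2 p. 54] -/
theorem isOfCMType_Y_of_isIsogenous_powSucc {E₀ : AbelianVariety ℂ} (hE₀ : IsOfCMType E₀) (hJ : D.𝒥.J.IsIsogenous (E₀.powSucc 2)) :
    IsOfCMType D.Y :=
  D.isOfCMType_Y ((isOfCMType_iff_of_isIsogenous hJ).2 ((isOfCMType_powSucc_iff 2).2 hE₀))

end SecantQuotientDatum

end Isogeny

/-! ## §2 The `E³`-type ∕ CM secant–quotient anchors are anchors of the André column -/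

section Anchors

variable {X : SchemeOver ℂ} {θ : complexBetti X 2} {γ : complexBetti X (2 * 3)}

/-- **A chart of an `E³`-type secant quotient is an elliptic-power sixfold**: for `e : X ≅ D.Y.X` with `J ∼ E₀³`, `dim E₀ = 1`, the variety `X`
is isomorphic to an abelian sixfold (`D.Y`) isogenous to `E₀⁶` — the first clause of `AbelianAll.ellipticPowerPolarisedAnchor 6`.
[cite: Andre1996Motifs, §6.3 Lemme 6.3.3 (ii) (p. 33)] [cite: Markman2025SecantWeil, §1.5 (p. 7)] -/
theorem SecantQuotientDatum.exists_ellipticPower_of_chart (D : SecantQuotientDatum) (e : X ≅ D.Y.X) {E₀ : AbelianVariety ℂ}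
    (hE₀ : E₀.dim = 1) (hJ : D.𝒥.J.IsIsogenous (E₀.powSucc 2)) :
    ∃ (A₀ E₀ : AbelianVariety ℂ) (N : ℕ), A₀.dim = 6 ∧ E₀.dim = 1 ∧ A₀.IsIsogenous (E₀.powSucc N) ∧ Nonempty (A₀.X ≅ X) :=
  ⟨D.Y, E₀, 5, D.dim_Y, hE₀, D.isIsogenous_Y_powSucc_five hJ, ⟨e.symm⟩⟩

/-- **A chart of a CM secant quotient is a CM sixfold**: for `e : X ≅ D.Y.X` with `J` of CM-type, `X` is isomorphic to a CM abelian sixfold —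
the first clause of `AbelianAll.cmPolarisedAnchor 6`. [cite: Milne1999, §2 p. 54] [cite: Markman2025SecantWeil, §1.5 (p. 7)] -/
theorem SecantQuotientDatum.exists_cm_of_chart (D : SecantQuotientDatum) (e : X ≅ D.Y.X) (hJ : IsOfCMType D.𝒥.J) :
    ∃ A₀ : AbelianVariety ℂ, A₀.dim = 6 ∧ IsOfCMType A₀ ∧ Nonempty (A₀.X ≅ X) :=
  ⟨D.Y, D.dim_Y, D.isOfCMType_Y hJ, ⟨e.symm⟩⟩

/-- **An `E³`-type PINNED anchor is an elliptic-power polarised anchor of the column** (`θ` is a polarisation class by the anchor's own clause).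
[cite: Andre1996Motifs, §6.3 Lemme 6.3.3 (ii) (p. 33)] [cite: Markman2025SecantWeil, §2.4 and §1.5] -/
theorem ellipticPowerPolarisedAnchor_of_secantQuotientAnchorsPinned (h : secantQuotientAnchorsPinned X θ)
    (hX : ∃ (A₀ E₀ : AbelianVariety ℂ) (N : ℕ), A₀.dim = 6 ∧ E₀.dim = 1 ∧ A₀.IsIsogenous (E₀.powSucc N) ∧ Nonempty (A₀.X ≅ X)) :
    ellipticPowerPolarisedAnchor 6 X θ := by
  obtain ⟨γ, hγ⟩ := h
  exact ⟨hX, hγ.isPolarizationClass⟩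

/-- **A CM PINNED anchor is a CM polarised anchor of the column.** [cite: Milne1999, §2 p. 54] [cite: Markman2025SecantWeil, §2.4 and §1.5] -/
theorem cmPolarisedAnchor_of_secantQuotientAnchorsPinned (h : secantQuotientAnchorsPinned X θ)
    (hX : ∃ A₀ : AbelianVariety ℂ, A₀.dim = 6 ∧ IsOfCMType A₀ ∧ Nonempty (A₀.X ≅ X)) :
    cmPolarisedAnchor 6 X θ := by
  obtain ⟨γ, hγ⟩ := h
  exact ⟨hX, hγ.isPolarizationClass⟩

/-- **At an `E³`-type anchor every pinned-served class is a rational ALGEBRAIC class** (served classes are rational of type `(3,3)`, and on a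
variety isogenous to a power of an elliptic curve every such class is algebraic — Tate–Murasaki ∕ van Geemen Thm. 4.3, the tree's
`mem_algebraicClasses_of_ellipticPowerAnchor`; also directly `IsSecantQuotientWeilClassAtPinned.mem_algebraicClasses`, p523449).
[cite: vanGeemen1994HodgeAV, Lemma 3.7 and Thm. 4.3] [cite: Markman2025SecantWeil, Thm. 1.4.1] -/
theorem mem_algebraicClasses_of_served_ellipticPower (hγ : γ ∈ secantQuotientServedClassesPinned X θ)
    (hX : ∃ (A₀ E₀ : AbelianVariety ℂ) (N : ℕ), A₀.dim = 6 ∧ E₀.dim = 1 ∧ A₀.IsIsogenous (E₀.powSucc N) ∧ Nonempty (A₀.X ≅ X)) :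
    IsRationalClass γ ∧ γ ∈ algebraicClasses X 3 := by
  obtain ⟨A₀, E₀, N, hd, hE₀, hiso, ⟨e₀⟩⟩ := hX
  exact ⟨hγ.isRationalClass, mem_algebraicClasses_of_ellipticPowerAnchor hd hE₀ hiso e₀ hγ.isRationalClass hγ.isOfHodgeType⟩

end Anchors

/-! ## §3 Restriction: 2a″ on a sub-family of anchors ⟸ carriers for algebraic classes there; the `E³`-type and CM instances BY NAME -/

section Restriction

variable {𝒪 : ObjClass}

/-- **2a″ RESTRICTED TO THE PINNED ANCHORS LYING IN `𝔄₀` ⟸ CARRIERS FOR ALGEBRAIC CLASSES AT THE POLARISED MEMBERS OF `𝔄₀`** (door-generic):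
a pinned-served class is rational and ALGEBRAIC (p523449) and `θ` is a polarisation class, so `anchoredCarrierAt_anti` applies.
[cite: Bloch1972Semiregularity, Remark (7.5)] [cite: Markman2025SecantWeil, Thm. 1.4.1 and §1.5] -/
theorem anchoredCarrierAt_secantQuotientPinned_and_of_polarised {𝔄₀ : SchemeOver ℂ → Prop}
    (h : AnchoredCarrierAt 𝒪 6 3 (fun X θ ↦ 𝔄₀ X ∧ IsPolarizationClass 6 X θ) (algebraicServedClasses 3)) :
    AnchoredCarrierAt 𝒪 6 3 (fun X θ ↦ secantQuotientAnchorsPinned X θ ∧ 𝔄₀ X) (fun X θ ↦ secantQuotientServedClassesPinned X θ) :=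
  anchoredCarrierAt_anti (𝔄' := fun X θ ↦ 𝔄₀ X ∧ IsPolarizationClass 6 X θ)
    (fun _ _ hXθ ↦ by obtain ⟨⟨γ, hγ⟩, h₀⟩ := hXθ; exact ⟨h₀, hγ.isPolarizationClass⟩)
    (fun _ _ _ _ hw ↦ IsSecantQuotientWeilClassAtPinned.mem_algebraicClasses hw) h

/-- The same for v3's un-pinned anchor data `(secantQuotientAnchors, secantQuotientServedClasses)`.
[cite: Bloch1972Semiregularity, Remark (7.5)] [cite: Markman2025SecantWeil, Thm. 1.4.1 and §1.5] -/
theorem anchoredCarrierAt_secantQuotient_and_of_polarised {𝔄₀ : SchemeOver ℂ → Prop}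
    (h : AnchoredCarrierAt 𝒪 6 3 (fun X θ ↦ 𝔄₀ X ∧ IsPolarizationClass 6 X θ) (algebraicServedClasses 3)) :
    AnchoredCarrierAt 𝒪 6 3 (fun X θ ↦ secantQuotientAnchors X θ ∧ 𝔄₀ X) (fun X θ ↦ secantQuotientServedClasses X θ) :=
  anchoredCarrierAt_anti (𝔄' := fun X θ ↦ 𝔄₀ X ∧ IsPolarizationClass 6 X θ)
    (fun _ _ hXθ ↦ by obtain ⟨⟨γ, hγ⟩, h₀⟩ := hXθ; exact ⟨h₀, hγ.isPolarizationClass⟩)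
    (fun _ _ _ _ hw ↦ IsSecantQuotientWeilClassAt.mem_algebraicClasses hw) h

/-- **2a″ AT THE `E³`-TYPE (ELLIPTIC-POWER) PINNED ANCHORS ⟸ THE COLUMN'S NODE `EllipticPowerAlgebraicCarriers 𝒪`** (at `(n, p) = (6, 3)`:
`2 ≤ 3`, `3 + 2 ≤ 6`). Door-generic. Nothing says the node holds. [cite: Andre1996Motifs, §6.3 Lemme 6.3.3 (ii) (p. 33)]
[cite: Bloch1972Semiregularity, Remark (7.5)] [cite: Markman2025SecantWeil, Thm. 1.4.1 and §1.5] -/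
theorem anchoredCarrierAt_secantQuotientPinned_ellipticPower_of_ellipticPowerAlgebraicCarriers (h : EllipticPowerAlgebraicCarriers 𝒪) :
    AnchoredCarrierAt 𝒪 6 3
      (fun X θ ↦ secantQuotientAnchorsPinned X θ ∧
        ∃ (A₀ E₀ : AbelianVariety ℂ) (N : ℕ), A₀.dim = 6 ∧ E₀.dim = 1 ∧ A₀.IsIsogenous (E₀.powSucc N) ∧ Nonempty (A₀.X ≅ X))
      (fun X θ ↦ secantQuotientServedClassesPinned X θ) :=
  anchoredCarrierAt_secantQuotientPinned_and_of_polarised (h 6 3 (by norm_num) (by norm_num))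

/-- **2a″ AT THE CM PINNED ANCHORS ⟸ CM-ANCHORED CARRIERS FOR ALGEBRAIC CLASSES AT `(6, 3)`** (displayed instance; the column's node
`CMAlgebraicCarriers 𝒪` is stated for `n ≥ 2p + 4` and does not cover `(6,3)`). Door-generic. [cite: Milne1999, §2 p. 54]
[cite: Bloch1972Semiregularity, Remark (7.5)] [cite: Markman2025SecantWeil, Thm. 1.4.1 and §1.5] -/
theorem anchoredCarrierAt_secantQuotientPinned_cm_of_cmAlgebraicCarrierAt
    (h : AnchoredCarrierAt 𝒪 6 3 (cmPolarisedAnchor 6) (algebraicServedClasses 3)) :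
    AnchoredCarrierAt 𝒪 6 3
      (fun X θ ↦ secantQuotientAnchorsPinned X θ ∧ ∃ A₀ : AbelianVariety ℂ, A₀.dim = 6 ∧ IsOfCMType A₀ ∧ Nonempty (A₀.X ≅ X))
      (fun X θ ↦ secantQuotientServedClassesPinned X θ) :=
  anchoredCarrierAt_secantQuotientPinned_and_of_polarised h

/-- **TWISTED DOOR, every `C`: 2a″ at the `E³`-type pinned anchors ⟸ `EllipticPowerAlgebraicTwistedCarriers`** — the statement of the stub
`stub_anchorCarrier_63_secantQuotientPinned` RESTRICTED to the split special fibres of `E³`-type, from the column's node by name.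
[cite: Andre1996Motifs, §6.3 Lemme 6.3.3 (ii) (p. 33)] [cite: Markman2025SecantWeil, Thm. 1.4.1, §1.5 and §7.3] [cite: Bloch1972Semiregularity, Remark (7.5)] -/
theorem anchoredCarrierAt_tw_secantQuotientPinned_ellipticPower_of_ellipticPowerAlgebraicTwistedCarriers
    (h : EllipticPowerAlgebraicTwistedCarriers) (C : ChernCharacterBetti) :
    AnchoredCarrierAt (Literature.AlgebraicGeometry.HodgeTheory.twistedReflexiveClass C
        (fun n X₀ I E => Summit.Ventures.HSemireg.gluableSigmaAdmissible n X₀ I E ∨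
          Literature.AlgebraicGeometry.HodgeTheory.bfSingleAdmissible n X₀ I E)) 6 3
      (fun X θ ↦ secantQuotientAnchorsPinned X θ ∧
        ∃ (A₀ E₀ : AbelianVariety ℂ) (N : ℕ), A₀.dim = 6 ∧ E₀.dim = 1 ∧ A₀.IsIsogenous (E₀.powSucc N) ∧ Nonempty (A₀.X ≅ X))
      (fun X θ ↦ secantQuotientServedClassesPinned X θ) :=
  anchoredCarrierAt_secantQuotientPinned_ellipticPower_of_ellipticPowerAlgebraicCarriers (h C)

/-- **Conversely, 2a″ implies each restriction** (fewer anchors = a weaker statement): the restricted statements of this section are honest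
special cases of the stub, not re-cuts. [cite: Bloch1972Semiregularity, Remark (7.5)] [cite: Markman2025SecantWeil, Thm. 1.4.1] -/
theorem anchoredCarrierAt_secantQuotientPinned_and_of_secantQuotientAnchorCarrier63Pinned {C : ChernCharacterBetti}
    (h : SecantQuotientAnchorCarrier63Pinned C) (𝔄₀ : SchemeOver ℂ → Prop) :
    AnchoredCarrierAt (Literature.AlgebraicGeometry.HodgeTheory.twistedReflexiveClass C
        (fun n X₀ I E => Summit.Ventures.HSemireg.gluableSigmaAdmissible n X₀ I E ∨
          Literature.AlgebraicGeometry.HodgeTheory.bfSingleAdmissible n X₀ I E)) 6 3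
      (fun X θ ↦ secantQuotientAnchorsPinned X θ ∧ 𝔄₀ X) (fun X θ ↦ secantQuotientServedClassesPinned X θ) :=
  anchoredCarrierAt_anti (𝔄' := fun X θ ↦ secantQuotientAnchorsPinned X θ) (fun _ _ hXθ ↦ hXθ.1) (fun _ _ _ ↦ subset_rfl) h

/-- **At a single `E³`-type datum**: the node gives, on EVERY chart `e : X ≅ D.Y.X` of a datum with `J ∼ E₀³`, at every pinned polarisation
`θ` and for every pinned-served rational class `w`, an `𝒪`-datum with `κ₃ = a·w + c₃·θ³`, `a ≠ 0`, sides on the `θ`-ray — the per-variety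
form in which a chart lemma consumes it. [cite: Andre1996Motifs, §6.3 Lemme 6.3.3 (ii) (p. 33)] [cite: Bloch1972Semiregularity, Remark (7.5)] -/
theorem exists_datum_of_ellipticPowerAlgebraicCarriers_of_chart (h : EllipticPowerAlgebraicCarriers 𝒪) (D : SecantQuotientDatum)
    {X : SchemeOver ℂ} (e : X ≅ D.Y.X) {E₀ : AbelianVariety ℂ} (hE₀ : E₀.dim = 1) (hJ : D.𝒥.J.IsIsogenous (E₀.powSucc 2))
    {θ : complexBetti X 2} {w : complexBetti X (2 * 3)} (hw : w ∈ secantQuotientServedClassesPinned X θ) :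
    ∃ (I : Finset ℕ) (κ : (q : ℕ) → complexBetti X (2 * q)) (a : ℂ) (c : ℕ → ℂ),
      3 ∈ I ∧ 𝒪 6 X I κ ∧ a ≠ 0 ∧ κ 3 = a • w + c 3 • cupPowTwo θ 3 ∧ ∀ q ∈ I, q ≠ 3 → κ q = c q • cupPowTwo θ q :=
  anchoredCarrierAt_secantQuotientPinned_ellipticPower_of_ellipticPowerAlgebraicCarriers h X θ
    ⟨secantQuotientAnchorsPinned_of_mem hw, D.exists_ellipticPower_of_chart e hE₀ hJ⟩ w hw hw.isRationalClass

end Restriction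

/-! ## §4 The served half of the `(6,3)` cell on the pencils through an `E³`-type anchor fibre -/

section Cell

variable {𝒪 : ObjClass}

/-- **THE `(6,3)` CELL ON EVERY PENCIL WITH AN `E³`-TYPE PINNED-SERVED FIBRE ⟸ THE NODE** (door-generic): on a one-parameter abelian sixfold
pencil of the crux's shape which has a fibre `𝒳_{sₐ}`, polarised by the restriction of a global fibrewise rational `(1,1)` class, that is an
`E³`-type pinned anchor serving `W|_{sₐ}`, the node's datum at `sₐ` is transported to the cell's conclusion by the PART Z-b §5 engine
(`under_hasServedFibre_of_anchoredCarrierAt`). [cite: Bloch1972Semiregularity, Remark (7.5)] [cite: vanGeemen1994HodgeAV, §2.4 and Thm. 4.11]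
[cite: Andre1996Motifs, §6.3 Lemme 6.3.3 (ii) (p. 33)] -/
theorem under_hasServedFibre_secantQuotientPinned_ellipticPower_of_ellipticPowerAlgebraicCarriers (h : EllipticPowerAlgebraicCarriers 𝒪) :
    LefAtExceptionalRegimeAtUnder 𝒪 6 3 (HasServedFibre 6 3
      (fun X θ ↦ secantQuotientAnchorsPinned X θ ∧
        ∃ (A₀ E₀ : AbelianVariety ℂ) (N : ℕ), A₀.dim = 6 ∧ E₀.dim = 1 ∧ A₀.IsIsogenous (E₀.powSucc N) ∧ Nonempty (A₀.X ≅ X))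
      (fun X θ ↦ secantQuotientServedClassesPinned X θ)) :=
  under_hasServedFibre_of_anchoredCarrierAt (anchoredCarrierAt_secantQuotientPinned_ellipticPower_of_ellipticPowerAlgebraicCarriers h)

/-- **Twisted door, every `C`.** [cite: Bloch1972Semiregularity, Remark (7.5)] [cite: Markman2025SecantWeil, §7.3 and Thm. 1.5.1] -/
theorem under_hasServedFibre_tw_secantQuotientPinned_ellipticPower_of_ellipticPowerAlgebraicTwistedCarriers
    (h : EllipticPowerAlgebraicTwistedCarriers) (C : ChernCharacterBetti) :
    LefAtExceptionalRegimeAtUnder (Literature.AlgebraicGeometry.HodgeTheory.twistedReflexiveClass C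
        (fun n X₀ I E => Summit.Ventures.HSemireg.gluableSigmaAdmissible n X₀ I E ∨
          Literature.AlgebraicGeometry.HodgeTheory.bfSingleAdmissible n X₀ I E)) 6 3 (HasServedFibre 6 3
      (fun X θ ↦ secantQuotientAnchorsPinned X θ ∧
        ∃ (A₀ E₀ : AbelianVariety ℂ) (N : ℕ), A₀.dim = 6 ∧ E₀.dim = 1 ∧ A₀.IsIsogenous (E₀.powSucc N) ∧ Nonempty (A₀.X ≅ X))
      (fun X θ ↦ secantQuotientServedClassesPinned X θ)) :=
  under_hasServedFibre_secantQuotientPinned_ellipticPower_of_ellipticPowerAlgebraicCarriers (h C)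

end Cell

/-! ## §5 Spreading from an `E³`-type anchor fibre: the served-fibre lemmas instantiated -/

section Spread

variable {𝒪 : ObjClass} {𝒳 S : SchemeOver ℂ} {f : 𝒳 ⟶ S}

/-- **DOOR ∧ NODE ⟹ `W` ALGEBRAIC NEAR AN `E³`-TYPE ANCHOR FIBRE** (smooth base of any dimension; door-generic): `f : 𝒳 ⟶ S` smooth projective of
relative dimension `6` over a smooth `S`; `Θ` a global class with rational `(1,1)` fibre restrictions, `W` a global class with rational `(3,3)`
fibre restrictions; at `s₀` a chart `e : 𝒳_{s₀} ≅ D.Y.X` of an `E³`-type datum (`J ∼ E₀³`) and `W|_{s₀}` pinned-served at `Θ|_{s₀}`. Then `W|_t`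
is algebraic for all `t` in an open neighbourhood of `s₀` (ab-andre-2 g60's local served-fibre lemma fed with §3).
[cite: BuchweitzFlenner2003, §5 Thm. 5.1] [cite: Markman2025SecantWeil, §1.5 and Thm. 1.5.1] [cite: Andre1996Motifs, §6.3 Lemme 6.3.3 (ii)] -/
theorem exists_isOpen_forall_mem_algebraicClasses_of_ellipticPower_chart (hT : LocalVariationalHodgeFor 𝒪)
    (h : EllipticPowerAlgebraicCarriers 𝒪) (hf : IsSmoothProjectiveFamily f 6) (hsm : AlgebraicGeometry.Smooth S.hom)
    (Θ : complexBetti 𝒳 2) (hΘQ : ∀ s : ComplexPoints S, IsRationalClass (complexBetti.map (fiberι f s) 2 Θ))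
    (hΘH : ∀ s : ComplexPoints S, IsOfHodgeType 6 (fiberOver f s) 2 1 1 (complexBetti.map (fiberι f s) 2 Θ))
    (W : complexBetti 𝒳 (2 * 3))
    (hW : ∀ s : ComplexPoints S, IsRationalClass (complexBetti.map (fiberι f s) (2 * 3) W) ∧
      IsOfHodgeType 6 (fiberOver f s) (2 * 3) 3 3 (complexBetti.map (fiberι f s) (2 * 3) W))
    (s₀ : ComplexPoints S) (D : SecantQuotientDatum) (e : fiberOver f s₀ ≅ D.Y.X) {E₀ : AbelianVariety ℂ} (hE₀ : E₀.dim = 1)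
    (hJ : D.𝒥.J.IsIsogenous (E₀.powSucc 2))
    (hserved : complexBetti.map (fiberι f s₀) (2 * 3) W ∈
      secantQuotientServedClassesPinned (fiberOver f s₀) (complexBetti.map (fiberι f s₀) 2 Θ)) :
    ∃ U : Set (ComplexPoints S), IsOpen U ∧ s₀ ∈ U ∧
      ∀ t ∈ U, complexBetti.map (fiberι f t) (2 * 3) W ∈ algebraicClasses (fiberOver f t) 3 :=
  exists_isOpen_forall_mem_algebraicClasses_of_anchoredCarrierAt_at hT
    (anchoredCarrierAt_secantQuotientPinned_ellipticPower_of_ellipticPowerAlgebraicCarriers h) hf hsm Θ hΘQ hΘH W hW s₀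
    ⟨secantQuotientAnchorsPinned_of_mem hserved, D.exists_ellipticPower_of_chart e hE₀ hJ⟩ hserved

/-- **DOOR ∧ NODE ⟹ `W` ALGEBRAIC ON EVERY FIBRE OF A PENCIL THROUGH AN `E³`-TYPE ANCHOR FIBRE** (smooth irreducible AFFINE curve base,
quasi-projective total space; door-generic): PART AA-e's served-fibre lemma (`mem_algebraicClasses_of_anchoredCarrierAt_of_hasServedFibre`) fed
with §3. This is the director's «then spread by the served-fibre lemma», in the kernel, modulo the door and the node BY NAME.
[cite: BuchweitzFlenner2003, §5 Thm. 5.1] [cite: Markman2025SecantWeil, Thm. 1.5.1] [cite: Andre1996Motifs, §6.3 Lemme 6.3.3 (ii)] -/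
theorem mem_algebraicClasses_of_ellipticPower_servedFibre (hT : LocalVariationalHodgeFor 𝒪) (h : EllipticPowerAlgebraicCarriers 𝒪)
    (hf : IsSmoothProjectiveFamily f 6) (h𝒳 : IsQuasiProjectiveOver 𝒳) (hirr : IrreducibleSpace S.left) (haff : IsAffine S.left)
    (hsm : AlgebraicGeometry.Smooth S.hom) (hdim : topologicalKrullDim S.left = 1) (W : complexBetti 𝒳 (2 * 3))
    (hW : ∀ s : ComplexPoints S, IsRationalClass (complexBetti.map (fiberι f s) (2 * 3) W) ∧
      IsOfHodgeType 6 (fiberOver f s) (2 * 3) 3 3 (complexBetti.map (fiberι f s) (2 * 3) W))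
    (hsf : HasServedFibre 6 3
      (fun X θ ↦ secantQuotientAnchorsPinned X θ ∧
        ∃ (A₀ E₀ : AbelianVariety ℂ) (N : ℕ), A₀.dim = 6 ∧ E₀.dim = 1 ∧ A₀.IsIsogenous (E₀.powSucc N) ∧ Nonempty (A₀.X ≅ X))
      (fun X θ ↦ secantQuotientServedClassesPinned X θ) f W)
    (s : ComplexPoints S) : complexBetti.map (fiberι f s) (2 * 3) W ∈ algebraicClasses (fiberOver f s) 3 :=
  mem_algebraicClasses_of_anchoredCarrierAt_of_hasServedFibre hT
    (anchoredCarrierAt_secantQuotientPinned_ellipticPower_of_ellipticPowerAlgebraicCarriers h) hf h𝒳 hirr haff hsm hdim W hW hsf s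

/-- **A chart of an `E³`-type datum makes the fibre served** (the `HasServedFibre` witness of the previous theorem from concrete data): a point
`sₐ`, a global class `Θ` with rational `(1,1)` fibre restrictions, a chart `e : 𝒳_{sₐ} ≅ D.Y.X` of a datum with `J ∼ E₀³`, and `W|_{sₐ}`
pinned-served at `Θ|_{sₐ}`. [cite: Markman2025SecantWeil, §1.5 and Thm. 1.4.1] [cite: Andre1996Motifs, §6.3 Lemme 6.3.3 (ii)] -/
theorem hasServedFibre_secantQuotientPinned_ellipticPower_of_chart (Θ : complexBetti 𝒳 2)
    (hΘQ : ∀ s : ComplexPoints S, IsRationalClass (complexBetti.map (fiberι f s) 2 Θ))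
    (hΘH : ∀ s : ComplexPoints S, IsOfHodgeType 6 (fiberOver f s) 2 1 1 (complexBetti.map (fiberι f s) 2 Θ))
    (W : complexBetti 𝒳 (2 * 3)) (sₐ : ComplexPoints S) (D : SecantQuotientDatum) (e : fiberOver f sₐ ≅ D.Y.X) {E₀ : AbelianVariety ℂ}
    (hE₀ : E₀.dim = 1) (hJ : D.𝒥.J.IsIsogenous (E₀.powSucc 2))
    (hserved : complexBetti.map (fiberι f sₐ) (2 * 3) W ∈
      secantQuotientServedClassesPinned (fiberOver f sₐ) (complexBetti.map (fiberι f sₐ) 2 Θ)) :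
    HasServedFibre 6 3
      (fun X θ ↦ secantQuotientAnchorsPinned X θ ∧
        ∃ (A₀ E₀ : AbelianVariety ℂ) (N : ℕ), A₀.dim = 6 ∧ E₀.dim = 1 ∧ A₀.IsIsogenous (E₀.powSucc N) ∧ Nonempty (A₀.X ≅ X))
      (fun X θ ↦ secantQuotientServedClassesPinned X θ) f W :=
  ⟨sₐ, Θ, hΘQ, hΘH, ⟨secantQuotientAnchorsPinned_of_mem hserved, D.exists_ellipticPower_of_chart e hE₀ hJ⟩, hserved⟩

/-- **TWISTED DOOR, every `C`: the road's binder `TwistedPerfectDoorVHC C AdmTw` and the node `EllipticPowerAlgebraicTwistedCarriers` make `W`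
algebraic on every fibre of every pencil of the crux's shape through an `E³`-type pinned-served fibre.** Modulo two OPEN statements by name
(the binder and the node); `HC_CM` absent; nothing here says either holds. [cite: BuchweitzFlenner2003, §5 Thm. 5.1]
[cite: Markman2025SecantWeil, §7.3 and Thm. 1.5.1] [cite: Pridham2024Semiregularity, Cor. 2.25 and Rem. 2.26] -/
theorem mem_algebraicClasses_of_twistedPerfectDoorVHC_of_ellipticPowerAlgebraicTwistedCarriers_servedFibre {C : ChernCharacterBetti}
    (hT : TwistedPerfectDoorVHC C (fun n X₀ I E => Summit.Ventures.HSemireg.gluableSigmaAdmissible n X₀ I E ∨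
      Literature.AlgebraicGeometry.HodgeTheory.bfSingleAdmissible n X₀ I E))
    (h : EllipticPowerAlgebraicTwistedCarriers)
    (hf : IsSmoothProjectiveFamily f 6) (h𝒳 : IsQuasiProjectiveOver 𝒳) (hirr : IrreducibleSpace S.left) (haff : IsAffine S.left)
    (hsm : AlgebraicGeometry.Smooth S.hom) (hdim : topologicalKrullDim S.left = 1) (W : complexBetti 𝒳 (2 * 3))
    (hW : ∀ s : ComplexPoints S, IsRationalClass (complexBetti.map (fiberι f s) (2 * 3) W) ∧
      IsOfHodgeType 6 (fiberOver f s) (2 * 3) 3 3 (complexBetti.map (fiberι f s) (2 * 3) W))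
    (hsf : HasServedFibre 6 3
      (fun X θ ↦ secantQuotientAnchorsPinned X θ ∧
        ∃ (A₀ E₀ : AbelianVariety ℂ) (N : ℕ), A₀.dim = 6 ∧ E₀.dim = 1 ∧ A₀.IsIsogenous (E₀.powSucc N) ∧ Nonempty (A₀.X ≅ X))
      (fun X θ ↦ secantQuotientServedClassesPinned X θ) f W)
    (s : ComplexPoints S) : complexBetti.map (fiberι f s) (2 * 3) W ∈ algebraicClasses (fiberOver f s) 3 :=
  mem_algebraicClasses_of_ellipticPower_servedFibre ((twistedPerfectDoorVHC_iff_localVariationalHodgeFor C _).1 hT) (h C)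
    hf h𝒳 hirr haff hsm hdim W hW hsf s

end Spread

end Summit.HodgeConjecture.HodgeConjecture.Ring2.SemiregularRepresentatives

end
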